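/-
Copyright: b2b-lace packet (carver, gen 53).  [FvdH17] (5.6) norms of the row `a = 2` element cells: the supremum
over the free endpoint `v` runs over ALL of `ℤ^d`; splitting it into the endpoint classes `{0}` / odd sites / even
sites `≠ 0` and pricing each class by the landed EXL-XSLOT extractions (leaves I / F / S / S1) gives the cells at
(5.40)/(5.41) slot prices with class-wise count majorants — node ROW2-OPEN of the cell's N76 map.
Proofs only; no named fact; no numeral; no dimension.
-/
import Literature.Probability.FitznerVanDerHofstad2017.NobleExactLegSlotsFirst
import Literature.Probability.FitznerVanDerHofstad2017.NobleExactLegSlotsSquare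
import Literature.Probability.FitznerVanDerHofstad2017.NobleExactLegSlotsSquareFirst
import Literature.Probability.FitznerVanDerHofstad2017.SawCountRecursion
import HarnessLib

/-!
# [FvdH17] row `a = 2` of the element tables at slot prices, endpoint classes `{0}` / odd / even

The (5.6) norms `(𝐀)_{a,b} = sup_v Σ_{x,y} A^{a,b}(0,v,x,y)` ([FvdH17] §5.1) take the supremum over every `v ∈ ℤ^d`;
for the row `a = 2` (App. B Tables B.3/B.4, rows `(2,b)`) the letters are the repulsive triangle / square with the free
endpoint `v`: `(𝐀)_{2,1} = sup_v Σ 𝓣_{1,1̲,0}(x,y,v)`, `(𝐀^ι)_{2,0} = sup_v Σ_x Σ_κ 𝓣_{1̲,1,0}(e_κ,x,v)`,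
`(𝐀^ι)_{2,1} = sup_v Σ Σ_κ 𝓢_{1̲,0,1̲,0}(e_κ,x,y,v)`, `(𝐀^ι)_{2,2} = sup_v Σ Σ_κ 𝓢_{1̲,0,2,0}(e_κ,x,y,v)`
(`NobleElementsClosedFormsRows`).  Each carries exact unit lines, so the landed trail-level extractions of
[NoBLE17] §5.3.2 (5.40)/(5.41) apply at every fixed endpoint `v` (`tsum_tsum_perc_T_ge_eqOne_ge_le_ofReal`,
`tsum_sum_perc_T_eqOne_ge_ge_stepVec_le_ofReal`, `tsum_tsum_sum_perc_S_eqOne_ge_eqOne_ge_stepVec_le_ofReal`,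
`tsum_tsum_sum_perc_S_eqOne_ge_ge_ge_stepVec_le_ofReal`).  By lattice parity the trail-word counts to `v` vanish unless
`L ≡ ‖v‖₁ (mod 2)` (`card_trailWordsTo_eq_zero_of_odd`), so the natural count majorants are CLASS-WISE: one for the
closed class `v = 0`, one for the odd sites, one for the even sites `≠ 0` — this is the form in which the numerical
companion of [FvdH17] prices the open diagrams (maximum over the endpoint classes of the class sums).  The theorems
`perc_mat*_two_*_le_xslot₃` state the cell bounds as `ofReal (max slot₀ (max slot_odd slot_even))` with independent
slot orders `M₀, M₁, M₂`, count majorants and remainder constants per class; the corollaries `perc_mat*_two_*_le_xslot` are the one-class forms on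
`Set.univ`.  Unconditional, every `d ≥ 2` and `p < p_c`; no numeral, no dimension.

## References
* [FvdH17] R. Fitzner, R. van der Hofstad, Mean-field behavior for nearest-neighbor percolation in `d > 10`,
  Electron. J. Probab. 22 (2017) no. 43; arXiv:1506.07977v2 — §5.1 (5.6) (p. 49); App. B Tables B.3 row (2,1) (p. 74),
  B.4 rows (2,0), (2,1), (2,2) (p. 75); §4.2 (4.16)–(4.18).
* [NoBLE17] R. Fitzner, R. van der Hofstad, Generalized approach to the non-backtracking lace expansion,
  Probab. Theory Relat. Fields 169 (2017) 1041–1119 — §5.3.2 (5.40)–(5.42) p. 1098.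
-/

namespace Literature.Probability.FitznerVanDerHofstad2017.NobleBlocks

open _root_.MeasureTheory Finset
open scoped BigOperators ENNReal
open Literature.Probability.LatticeModels Literature.Probability.Percolation
open Literature.Barriers.CriticalPhenomena
open Literature.Probability.FitznerVanDerHofstad2017
open Literature.Probability.FitznerVanDerHofstad2017.NobleBlocks.LenIdx

variable {d : ℕ} (p : unitInterval)

section Classes

/-- Every site is `0`, or has odd `ℓ¹`-norm, or is a non-zero site of even `ℓ¹`-norm. [folklore] -/
private theorem eq_zero_or_odd_or_even (v : Site d) :
    v = 0 ∨ l1Norm v % 2 = 1 ∨ (v ≠ 0 ∧ l1Norm v % 2 = 0) := by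
  by_cases hv : v = 0
  · exact Or.inl hv
  · rcases Nat.mod_two_eq_zero_or_one (l1Norm v) with h | h
    · exact Or.inr (Or.inr ⟨hv, h⟩)
    · exact Or.inr (Or.inl h)

/-- `ofReal` of a three-way `max` dominates each member (left). [folklore] -/
private theorem ofReal_le_ofReal_max₁ {a b c t : ℝ} (h : t ≤ a) :
    ENNReal.ofReal t ≤ ENNReal.ofReal (max a (max b c)) :=
  ENNReal.ofReal_le_ofReal (h.trans (le_max_left _ _))

/-- `ofReal` of a three-way `max` dominates each member (middle). [folklore] -/
private theorem ofReal_le_ofReal_max₂ {a b c t : ℝ} (h : t ≤ b) :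
    ENNReal.ofReal t ≤ ENNReal.ofReal (max a (max b c)) :=
  ENNReal.ofReal_le_ofReal (h.trans ((le_max_left _ _).trans (le_max_right _ _)))

/-- `ofReal` of a three-way `max` dominates each member (right). [folklore] -/
private theorem ofReal_le_ofReal_max₃ {a b c t : ℝ} (h : t ≤ c) :
    ENNReal.ofReal t ≤ ENNReal.ofReal (max a (max b c)) :=
  ENNReal.ofReal_le_ofReal (h.trans ((le_max_right _ _).trans (le_max_right _ _)))

end Classes

section Cells

/-- **`(A^ι)_{2,0}` by EXL-XSLOT, endpoint classes**: `(A^ι)_{2,0} = sup_v Σ_x Σ_κ 𝓣_{1̲,1,0}(e_κ,x,v)` is at most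
`ofReal (max (bubbleSlotR p Γ̄₂ 2 0 M₀ N₀ A₁ A₂) (max (… M₁ N₁ B₁ B₂) (… M₂ N₂ C₁ C₂)))`, where `N₀` majorises the closed
trail-word counts, `N₁` the counts to every odd site, `N₂` the counts to every even site `≠ 0`, and `A`, `B`, `C` are
remainder constants for the slot lists `[M]`, `[M, 0]` on the classes `{0}`, odd, even `≠ 0`, each class `c` at its OWN slot order `M_c ≥ 1` — the
first-leg extraction at every fixed endpoint, no peel, no `2d·p`.
[cite: FitznerVanDerHofstad2017, App. B Table B.4 row (2,0) (arXiv:1506.07977v2 p. 75); §5.1 (5.6) p. 49]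
[cite: FitznerVanDerHofstad2016NoBLE, §5.3.2 (5.40) (PTRF 169 (2017) p. 1098)] -/
theorem perc_matAiota_two_zero_le_xslot₃ (hd : 2 ≤ d) (hp : p < criticalProbI d)
    {M₀ M₁ M₂ : ℕ} (hM₀ : 1 ≤ M₀) (hM₁ : 1 ≤ M₁) (hM₂ : 1 ≤ M₂)
    {N₀ N₁ N₂ : ℕ → ℕ} (hN₀ : ∀ L, (trailWordsTo d L (0 : Site d)).card ≤ N₀ L)
    (hN₁ : ∀ L (v : Site d), l1Norm v % 2 = 1 → (trailWordsTo d L v).card ≤ N₁ L)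
    (hN₂ : ∀ L (v : Site d), v ≠ 0 → l1Norm v % 2 = 0 → (trailWordsTo d L v).card ≤ N₂ L)
    {A₁ A₂ B₁ B₂ C₁ C₂ : ℝ}
    (hA₁ : IsRemKernelConst d [M₀] ({0} : Set (Site d)) A₁)
    (hA₂ : IsRemKernelConst d [M₀, 0] ({0} : Set (Site d)) A₂)
    (hB₁ : IsRemKernelConst d [M₁] {v : Site d | l1Norm v % 2 = 1} B₁)
    (hB₂ : IsRemKernelConst d [M₁, 0] {v : Site d | l1Norm v % 2 = 1} B₂)
    (hC₁ : IsRemKernelConst d [M₂] {v : Site d | v ≠ 0 ∧ l1Norm v % 2 = 0} C₁)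
    (hC₂ : IsRemKernelConst d [M₂, 0] {v : Site d | v ≠ 0 ∧ l1Norm v % 2 = 0} C₂) :
    matAiota (Letters.perc d p) 2 0 ≤ ENNReal.ofReal (max (bubbleSlotR p (nobleSup2 d p) 2 0 M₀ N₀ A₁ A₂)
      (max (bubbleSlotR p (nobleSup2 d p) 2 0 M₁ N₁ B₁ B₂) (bubbleSlotR p (nobleSup2 d p) 2 0 M₂ N₂ C₁ C₂))) := by
  rw [matAiota_two_zero]
  refine iSup_le fun v => ?_
  rcases eq_zero_or_odd_or_even v with hv | hv | hv
  · subst hv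
    exact (tsum_sum_perc_T_eqOne_ge_ge_stepVec_le_ofReal p hd hp (m₂ := 1) (m₃ := 0) (by omega)
      (Set.mem_singleton _) hN₀ hA₁ hA₂).trans (ofReal_le_ofReal_max₁ le_rfl)
  · exact (tsum_sum_perc_T_eqOne_ge_ge_stepVec_le_ofReal p hd hp (m₂ := 1) (m₃ := 0) (by omega)
      (show v ∈ {v : Site d | l1Norm v % 2 = 1} from hv) (fun L => hN₁ L v hv) hB₁ hB₂).trans
      (ofReal_le_ofReal_max₂ le_rfl)
  · exact (tsum_sum_perc_T_eqOne_ge_ge_stepVec_le_ofReal p hd hp (m₂ := 1) (m₃ := 0) (by omega)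
      (show v ∈ {v : Site d | v ≠ 0 ∧ l1Norm v % 2 = 0} from hv) (fun L => hN₂ L v hv.1 hv.2) hC₁ hC₂).trans
      (ofReal_le_ofReal_max₃ le_rfl)

/-- **`(A^ι)_{2,0}` by EXL-XSLOT, one class**: with a count majorant `N` valid at EVERY endpoint and remainder constants
on all of `ℤ^d`, `(A^ι)_{2,0} ≤ ofReal (bubbleSlotR p Γ̄₂ 2 0 M N R₁ R₂)` (`1 ≤ M`).
[cite: FitznerVanDerHofstad2017, App. B Table B.4 row (2,0) (arXiv:1506.07977v2 p. 75); §5.1 (5.6) p. 49]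
[cite: FitznerVanDerHofstad2016NoBLE, §5.3.2 (5.40) (PTRF 169 (2017) p. 1098)] -/
theorem perc_matAiota_two_zero_le_xslot (hd : 2 ≤ d) (hp : p < criticalProbI d) {M : ℕ} (hM : 1 ≤ M)
    {N : ℕ → ℕ} (hN : ∀ L (v : Site d), (trailWordsTo d L v).card ≤ N L) {R₁ R₂ : ℝ}
    (hR₁ : IsRemKernelConst d [M] (Set.univ : Set (Site d)) R₁)
    (hR₂ : IsRemKernelConst d [M, 0] (Set.univ : Set (Site d)) R₂) :
    matAiota (Letters.perc d p) 2 0 ≤ ENNReal.ofReal (bubbleSlotR p (nobleSup2 d p) 2 0 M N R₁ R₂) := by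
  rw [matAiota_two_zero]
  exact iSup_le fun v => tsum_sum_perc_T_eqOne_ge_ge_stepVec_le_ofReal p hd hp (m₂ := 1) (m₃ := 0) (by omega)
    (Set.mem_univ v) (fun L => hN L v) hR₁ hR₂

/-- **`(A^ι)_{2,1}` by EXL-XSLOT, endpoint classes**: `(A^ι)_{2,1} = sup_v Σ_{x,y} Σ_κ 𝓢_{1̲,0,1̲,0}(e_κ,x,y,v)` is at most
`ofReal (max (bubbleSlotR p Γ̄₂ 1 1 M₀ N₀ A₁ A₂) (max (… M₁ N₁ B₁ B₂) (… M₂ N₂ C₁ C₂)))` (slot lists `[M_c]`, `[M_c−1, 1]`, one order `M_c ≥ 2`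
per class) — the two-exact-bond square extraction at every fixed endpoint.
[cite: FitznerVanDerHofstad2017, App. B Table B.4 row (2,1) (arXiv:1506.07977v2 p. 75); §5.1 (5.6) p. 49]
[cite: FitznerVanDerHofstad2016NoBLE, §5.3.2 (5.40) (PTRF 169 (2017) p. 1098)] -/
theorem perc_matAiota_two_one_le_xslot₃ (hd : 2 ≤ d) (hp : p < criticalProbI d)
    {M₀ M₁ M₂ : ℕ} (hM₀ : 2 ≤ M₀) (hM₁ : 2 ≤ M₁) (hM₂ : 2 ≤ M₂)
    {N₀ N₁ N₂ : ℕ → ℕ} (hN₀ : ∀ L, (trailWordsTo d L (0 : Site d)).card ≤ N₀ L)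
    (hN₁ : ∀ L (v : Site d), l1Norm v % 2 = 1 → (trailWordsTo d L v).card ≤ N₁ L)
    (hN₂ : ∀ L (v : Site d), v ≠ 0 → l1Norm v % 2 = 0 → (trailWordsTo d L v).card ≤ N₂ L)
    {A₁ A₂ B₁ B₂ C₁ C₂ : ℝ}
    (hA₁ : IsRemKernelConst d [M₀] ({0} : Set (Site d)) A₁)
    (hA₂ : IsRemKernelConst d [M₀ - 1, 1] ({0} : Set (Site d)) A₂)
    (hB₁ : IsRemKernelConst d [M₁] {v : Site d | l1Norm v % 2 = 1} B₁)
    (hB₂ : IsRemKernelConst d [M₁ - 1, 1] {v : Site d | l1Norm v % 2 = 1} B₂)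
    (hC₁ : IsRemKernelConst d [M₂] {v : Site d | v ≠ 0 ∧ l1Norm v % 2 = 0} C₁)
    (hC₂ : IsRemKernelConst d [M₂ - 1, 1] {v : Site d | v ≠ 0 ∧ l1Norm v % 2 = 0} C₂) :
    matAiota (Letters.perc d p) 2 1 ≤ ENNReal.ofReal (max (bubbleSlotR p (nobleSup2 d p) 1 1 M₀ N₀ A₁ A₂)
      (max (bubbleSlotR p (nobleSup2 d p) 1 1 M₁ N₁ B₁ B₂) (bubbleSlotR p (nobleSup2 d p) 1 1 M₂ N₂ C₁ C₂))) := by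
  rw [matAiota_two_one]
  refine iSup_le fun v => ?_
  rcases eq_zero_or_odd_or_even v with hv | hv | hv
  · subst hv
    exact (tsum_tsum_sum_perc_S_eqOne_ge_eqOne_ge_stepVec_le_ofReal p hd hp (m₂ := 0) (m₄ := 0) (by omega)
      (Set.mem_singleton _) hN₀ hA₁ hA₂).trans (ofReal_le_ofReal_max₁ le_rfl)
  · exact (tsum_tsum_sum_perc_S_eqOne_ge_eqOne_ge_stepVec_le_ofReal p hd hp (m₂ := 0) (m₄ := 0) (by omega)
      (show v ∈ {v : Site d | l1Norm v % 2 = 1} from hv) (fun L => hN₁ L v hv) hB₁ hB₂).trans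
      (ofReal_le_ofReal_max₂ le_rfl)
  · exact (tsum_tsum_sum_perc_S_eqOne_ge_eqOne_ge_stepVec_le_ofReal p hd hp (m₂ := 0) (m₄ := 0) (by omega)
      (show v ∈ {v : Site d | v ≠ 0 ∧ l1Norm v % 2 = 0} from hv) (fun L => hN₂ L v hv.1 hv.2) hC₁ hC₂).trans
      (ofReal_le_ofReal_max₃ le_rfl)

/-- **`(A^ι)_{2,1}` by EXL-XSLOT, one class** (`N` valid at every endpoint, constants on `ℤ^d`; `2 ≤ M`).
[cite: FitznerVanDerHofstad2017, App. B Table B.4 row (2,1) (arXiv:1506.07977v2 p. 75); §5.1 (5.6) p. 49]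
[cite: FitznerVanDerHofstad2016NoBLE, §5.3.2 (5.40) (PTRF 169 (2017) p. 1098)] -/
theorem perc_matAiota_two_one_le_xslot (hd : 2 ≤ d) (hp : p < criticalProbI d) {M : ℕ} (hM : 2 ≤ M)
    {N : ℕ → ℕ} (hN : ∀ L (v : Site d), (trailWordsTo d L v).card ≤ N L) {R₁ R₂ : ℝ}
    (hR₁ : IsRemKernelConst d [M] (Set.univ : Set (Site d)) R₁)
    (hR₂ : IsRemKernelConst d [M - 1, 1] (Set.univ : Set (Site d)) R₂) :
    matAiota (Letters.perc d p) 2 1 ≤ ENNReal.ofReal (bubbleSlotR p (nobleSup2 d p) 1 1 M N R₁ R₂) := by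
  rw [matAiota_two_one]
  exact iSup_le fun v => tsum_tsum_sum_perc_S_eqOne_ge_eqOne_ge_stepVec_le_ofReal p hd hp (m₂ := 0) (m₄ := 0)
    (by omega) (Set.mem_univ v) (fun L => hN L v) hR₁ hR₂

/-- **`(A^ι)_{2,2}` by EXL-XSLOT, endpoint classes**: `(A^ι)_{2,2} = sup_v Σ_{x,y} Σ_κ 𝓢_{1̲,0,2,0}(e_κ,x,y,v)` is at most
`ofReal (max (triangleSlotR p Γ̄₂ 1 2 0 M₀ N₀ A₁ A₂ A₃) (max (… M₁ N₁ B₁ B₂ B₃) (… M₂ N₂ C₁ C₂ C₃)))` (slot lists `[M_c]`,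
`[M_c, 0]`, `[M_c−2, 2, 0]`, one order `M_c ≥ 3` per class) — the first-bond square extraction at quadratic
multiplicity, every fixed endpoint.
[cite: FitznerVanDerHofstad2017, App. B Table B.4 row (2,2) (arXiv:1506.07977v2 p. 75); §5.1 (5.6) p. 49]
[cite: FitznerVanDerHofstad2016NoBLE, §5.3.2 (5.41) (PTRF 169 (2017) p. 1098)] -/
theorem perc_matAiota_two_two_le_xslot₃ (hd : 2 ≤ d) (hp : p < criticalProbI d)
    {M₀ M₁ M₂ : ℕ} (hM₀ : 3 ≤ M₀) (hM₁ : 3 ≤ M₁) (hM₂ : 3 ≤ M₂)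
    {N₀ N₁ N₂ : ℕ → ℕ} (hN₀ : ∀ L, (trailWordsTo d L (0 : Site d)).card ≤ N₀ L)
    (hN₁ : ∀ L (v : Site d), l1Norm v % 2 = 1 → (trailWordsTo d L v).card ≤ N₁ L)
    (hN₂ : ∀ L (v : Site d), v ≠ 0 → l1Norm v % 2 = 0 → (trailWordsTo d L v).card ≤ N₂ L)
    {A₁ A₂ A₃ B₁ B₂ B₃ C₁ C₂ C₃ : ℝ}
    (hA₁ : IsRemKernelConst d [M₀] ({0} : Set (Site d)) A₁)
    (hA₂ : IsRemKernelConst d [M₀, 0] ({0} : Set (Site d)) A₂)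
    (hA₃ : IsRemKernelConst d [M₀ - 2, 2, 0] ({0} : Set (Site d)) A₃)
    (hB₁ : IsRemKernelConst d [M₁] {v : Site d | l1Norm v % 2 = 1} B₁)
    (hB₂ : IsRemKernelConst d [M₁, 0] {v : Site d | l1Norm v % 2 = 1} B₂)
    (hB₃ : IsRemKernelConst d [M₁ - 2, 2, 0] {v : Site d | l1Norm v % 2 = 1} B₃)
    (hC₁ : IsRemKernelConst d [M₂] {v : Site d | v ≠ 0 ∧ l1Norm v % 2 = 0} C₁)
    (hC₂ : IsRemKernelConst d [M₂, 0] {v : Site d | v ≠ 0 ∧ l1Norm v % 2 = 0} C₂)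
    (hC₃ : IsRemKernelConst d [M₂ - 2, 2, 0] {v : Site d | v ≠ 0 ∧ l1Norm v % 2 = 0} C₃) :
    matAiota (Letters.perc d p) 2 2 ≤ ENNReal.ofReal (max (triangleSlotR p (nobleSup2 d p) 1 2 0 M₀ N₀ A₁ A₂ A₃)
      (max (triangleSlotR p (nobleSup2 d p) 1 2 0 M₁ N₁ B₁ B₂ B₃)
        (triangleSlotR p (nobleSup2 d p) 1 2 0 M₂ N₂ C₁ C₂ C₃))) := by
  rw [matAiota_two_two]
  refine iSup_le fun v => ?_
  rcases eq_zero_or_odd_or_even v with hv | hv | hv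
  · subst hv
    exact (tsum_tsum_sum_perc_S_eqOne_ge_ge_ge_stepVec_le_ofReal p hd hp (m₂ := 0) (m₃ := 2) (m₄ := 0)
      (by omega) (Set.mem_singleton _) hN₀ hA₁ hA₂ hA₃).trans (ofReal_le_ofReal_max₁ le_rfl)
  · exact (tsum_tsum_sum_perc_S_eqOne_ge_ge_ge_stepVec_le_ofReal p hd hp (m₂ := 0) (m₃ := 2) (m₄ := 0)
      (by omega) (show v ∈ {v : Site d | l1Norm v % 2 = 1} from hv) (fun L => hN₁ L v hv) hB₁ hB₂ hB₃).trans
      (ofReal_le_ofReal_max₂ le_rfl)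
  · exact (tsum_tsum_sum_perc_S_eqOne_ge_ge_ge_stepVec_le_ofReal p hd hp (m₂ := 0) (m₃ := 2) (m₄ := 0)
      (by omega) (show v ∈ {v : Site d | v ≠ 0 ∧ l1Norm v % 2 = 0} from hv) (fun L => hN₂ L v hv.1 hv.2)
      hC₁ hC₂ hC₃).trans (ofReal_le_ofReal_max₃ le_rfl)

/-- **`(A^ι)_{2,2}` by EXL-XSLOT, one class** (`N` valid at every endpoint, constants on `ℤ^d`; `3 ≤ M`).
[cite: FitznerVanDerHofstad2017, App. B Table B.4 row (2,2) (arXiv:1506.07977v2 p. 75); §5.1 (5.6) p. 49]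
[cite: FitznerVanDerHofstad2016NoBLE, §5.3.2 (5.41) (PTRF 169 (2017) p. 1098)] -/
theorem perc_matAiota_two_two_le_xslot (hd : 2 ≤ d) (hp : p < criticalProbI d) {M : ℕ} (hM : 3 ≤ M)
    {N : ℕ → ℕ} (hN : ∀ L (v : Site d), (trailWordsTo d L v).card ≤ N L) {R₁ R₂ R₃ : ℝ}
    (hR₁ : IsRemKernelConst d [M] (Set.univ : Set (Site d)) R₁)
    (hR₂ : IsRemKernelConst d [M, 0] (Set.univ : Set (Site d)) R₂)
    (hR₃ : IsRemKernelConst d [M - 2, 2, 0] (Set.univ : Set (Site d)) R₃) :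
    matAiota (Letters.perc d p) 2 2 ≤
      ENNReal.ofReal (triangleSlotR p (nobleSup2 d p) 1 2 0 M N R₁ R₂ R₃) := by
  rw [matAiota_two_two]
  exact iSup_le fun v => tsum_tsum_sum_perc_S_eqOne_ge_ge_ge_stepVec_le_ofReal p hd hp (m₂ := 0) (m₃ := 2)
    (m₄ := 0) (by omega) (Set.mem_univ v) (fun L => hN L v) hR₁ hR₂ hR₃

/-- **`(A)_{2,1}` by EXL-XSLOT, endpoint classes**: `(A)_{2,1} = sup_v Σ_{x,y} 𝓣_{1,1̲,0}(x,y,v)` is at most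
`ofReal (max (bubbleSlotR p Γ̄₂ 1 1 M₀ N₀ A₁ A₂) (max (… M₁ N₁ B₁ B₂) (… M₂ N₂ C₁ C₂)))` (slot lists `[M_c]`, `[M_c−1, 1]`, one order `M_c ≥ 1`
per class) — the middle-exact-bond triangle extraction at every fixed endpoint.
[cite: FitznerVanDerHofstad2017, App. B Table B.3 row (2,1) (arXiv:1506.07977v2 p. 74); §5.1 (5.6) p. 49]
[cite: FitznerVanDerHofstad2016NoBLE, §5.3.2 (5.40) (PTRF 169 (2017) p. 1098)] -/
theorem perc_matA_two_one_le_xslot₃ (hd : 2 ≤ d) (hp : p < criticalProbI d)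
    {M₀ M₁ M₂ : ℕ} (hM₀ : 1 ≤ M₀) (hM₁ : 1 ≤ M₁) (hM₂ : 1 ≤ M₂)
    {N₀ N₁ N₂ : ℕ → ℕ} (hN₀ : ∀ L, (trailWordsTo d L (0 : Site d)).card ≤ N₀ L)
    (hN₁ : ∀ L (v : Site d), l1Norm v % 2 = 1 → (trailWordsTo d L v).card ≤ N₁ L)
    (hN₂ : ∀ L (v : Site d), v ≠ 0 → l1Norm v % 2 = 0 → (trailWordsTo d L v).card ≤ N₂ L)
    {A₁ A₂ B₁ B₂ C₁ C₂ : ℝ}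
    (hA₁ : IsRemKernelConst d [M₀] ({0} : Set (Site d)) A₁)
    (hA₂ : IsRemKernelConst d [M₀ - 1, 1] ({0} : Set (Site d)) A₂)
    (hB₁ : IsRemKernelConst d [M₁] {v : Site d | l1Norm v % 2 = 1} B₁)
    (hB₂ : IsRemKernelConst d [M₁ - 1, 1] {v : Site d | l1Norm v % 2 = 1} B₂)
    (hC₁ : IsRemKernelConst d [M₂] {v : Site d | v ≠ 0 ∧ l1Norm v % 2 = 0} C₁)
    (hC₂ : IsRemKernelConst d [M₂ - 1, 1] {v : Site d | v ≠ 0 ∧ l1Norm v % 2 = 0} C₂) :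
    matA (Letters.perc d p) 2 1 ≤ ENNReal.ofReal (max (bubbleSlotR p (nobleSup2 d p) 1 1 M₀ N₀ A₁ A₂)
      (max (bubbleSlotR p (nobleSup2 d p) 1 1 M₁ N₁ B₁ B₂) (bubbleSlotR p (nobleSup2 d p) 1 1 M₂ N₂ C₁ C₂))) := by
  rw [matA_two_one]
  refine iSup_le fun v => ?_
  rcases eq_zero_or_odd_or_even v with hv | hv | hv
  · subst hv
    exact (tsum_tsum_perc_T_ge_eqOne_ge_le_ofReal p hd hp (m₁ := 1) (m₃ := 0) (by omega)
      (Set.mem_singleton _) hN₀ hA₁ hA₂).trans (ofReal_le_ofReal_max₁ le_rfl)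
  · exact (tsum_tsum_perc_T_ge_eqOne_ge_le_ofReal p hd hp (m₁ := 1) (m₃ := 0) (by omega)
      (show v ∈ {v : Site d | l1Norm v % 2 = 1} from hv) (fun L => hN₁ L v hv) hB₁ hB₂).trans
      (ofReal_le_ofReal_max₂ le_rfl)
  · exact (tsum_tsum_perc_T_ge_eqOne_ge_le_ofReal p hd hp (m₁ := 1) (m₃ := 0) (by omega)
      (show v ∈ {v : Site d | v ≠ 0 ∧ l1Norm v % 2 = 0} from hv) (fun L => hN₂ L v hv.1 hv.2) hC₁ hC₂).trans
      (ofReal_le_ofReal_max₃ le_rfl)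

/-- **`(A)_{2,1}` by EXL-XSLOT, one class** (`N` valid at every endpoint, constants on `ℤ^d`; `1 ≤ M`).
[cite: FitznerVanDerHofstad2017, App. B Table B.3 row (2,1) (arXiv:1506.07977v2 p. 74); §5.1 (5.6) p. 49]
[cite: FitznerVanDerHofstad2016NoBLE, §5.3.2 (5.40) (PTRF 169 (2017) p. 1098)] -/
theorem perc_matA_two_one_le_xslot (hd : 2 ≤ d) (hp : p < criticalProbI d) {M : ℕ} (hM : 1 ≤ M)
    {N : ℕ → ℕ} (hN : ∀ L (v : Site d), (trailWordsTo d L v).card ≤ N L) {R₁ R₂ : ℝ}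
    (hR₁ : IsRemKernelConst d [M] (Set.univ : Set (Site d)) R₁)
    (hR₂ : IsRemKernelConst d [M - 1, 1] (Set.univ : Set (Site d)) R₂) :
    matA (Letters.perc d p) 2 1 ≤ ENNReal.ofReal (bubbleSlotR p (nobleSup2 d p) 1 1 M N R₁ R₂) := by
  rw [matA_two_one]
  exact iSup_le fun v => tsum_tsum_perc_T_ge_eqOne_ge_le_ofReal p hd hp (m₁ := 1) (m₃ := 0) (by omega)
    (Set.mem_univ v) (fun L => hN L v) hR₁ hR₂

end Cells

end Literature.Probability.FitznerVanDerHofstad2017.NobleBlocks
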